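import Summits.QuantumFields.YangMills.Theorems.AllWindowsColdBoxBoxHighLineTiltCum5Trunc

/-!
# U5 ε₂-glue (G1), 13u³: `TiltThirdOrder` over `μ_D` along the UNtruncated tilt `tiltU β H`

Free-hands helper of the κ-lineage (ym-line-fcl-p3 g27) for the ε₂-half of the NEXT rung U5 (`stub_landauThirdOrder`, LINE-20,
⟨stmt-QuantumFields-24336⟩; planner ym-idea-2 g18 `Cruxes/BoxWindowHighSU2213/U5-BLOCKERS.md` §2 L3).  It is the third-order twin of
✓13u `GaussNormalForm.abs_tiltCov_sub_sub_tiltCum3_le_muD` (step 2 of LEAD ym-line-sfw-p2 g77's `ASSEMBLY-E2-memo.md`):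

* `Tilt.abs_tiltCov_sub_sub_tiltCum3_sub_tiltCum4_le_of_ae` — ✓`tiltThirdOrder` for a `U` that is bounded only on a set `D` of full measure
  (applied to `D.indicator U` and transported back by the a.e.-congruences ✓`tiltCov/Cum3/Cum4/Cum5_congr_ae`);
* ★ `GaussNormalForm.abs_tiltCov_sub_sub_tiltCum3_sub_half_tiltCum4_le_muD` — the instance on the assembler's
  `μ_D := (volume.restrict (smallField H s)).withDensity (ofReal ∘ gaussWeight β H)` with `U = tiltU β H` verbatim:
  `(∀ t ∈ [0,1], |κ₅,t(G₁,G₂; tiltU)| ≤ K) → |Cov₁ − Cov₀ − κ₃,₀ − κ₄,₀/2| ≤ K/6`.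
  Its `K`-input is the κ₅ size ✓`GaussNormalForm.abs_tiltCum5_muD_le_of_sizes` (U-slots being discharged by w5 g24); `κ₃,₀`, `κ₄,₀` are the
  exact-Wick slots of U5's lifts L2 / L3 (w3 g41, LEAD g78) after the D-truncation transfer (G2).

No definitions; standard axioms.  HONEST LABEL: helper-grade glue for U5 prep; U5, ⟨24004⟩, ⟨24336⟩ remain OPEN; route AllWindowsColdBox is DRAFT;
no crux, rung or summit is proved; the Yang–Mills mass gap is NOT proved by this file; no summit is proved by a line.
-/

set_option autoImplicit false

noncomputable section

open MeasureTheory Set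

namespace Summit.QuantumFields.YangMills.Theorems.AllWindowsColdBoxBoxHighLine

/-! ## §1 Abstract: third order under `D`-support hypotheses -/

namespace Tilt

variable {Ω : Type} [MeasurableSpace Ω] {μ : Measure Ω}

/-- ★ **`TiltThirdOrder` under D-support hypotheses.**  `μ` finite, `μ ≠ 0`, `μ`-a.e. point in the measurable set `D`; `U, G₁, G₂` measurable,
`|Gᵢ| ≤ B` everywhere, `|U| ≤ B` on `D`.  If `|κ₅,t| ≤ K` on `[0,1]` then `|Cov₁ − Cov₀ − κ₃,₀ − κ₄,₀/2| ≤ K/6` — for the UNtruncated `U`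
(✓`tiltThirdOrder` applied to `D.indicator U`). -/
theorem abs_tiltCov_sub_sub_tiltCum3_sub_tiltCum4_le_of_ae [IsFiniteMeasure μ] [NeZero μ] {D : Set Ω}
    (hDm : MeasurableSet D) (hD : ∀ᵐ x ∂μ, x ∈ D) {U G₁ G₂ : Ω → ℝ} (hU : Measurable U) (h₁ : Measurable G₁) (h₂ : Measurable G₂) {B : ℝ}
    (h₁b : ∀ x, |G₁ x| ≤ B) (h₂b : ∀ x, |G₂ x| ≤ B) (hUb : ∀ x ∈ D, |U x| ≤ B) {K : ℝ}
    (hK : ∀ t ∈ Set.Icc (0 : ℝ) 1, |tiltCum5 μ U t G₁ G₂| ≤ K) :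
    |tiltCov μ U 1 G₁ G₂ - tiltCov μ U 0 G₁ G₂ - tiltCum3 μ U 0 G₁ G₂ - tiltCum4 μ U 0 G₁ G₂ / 2| ≤ K / 6 := by
  have hae : D.indicator U =ᵐ[μ] U := indicator_ae_eq_of_ae_mem hD U
  have hB : 0 ≤ B := by
    rcases isEmpty_or_nonempty Ω with hΩ | ⟨⟨x⟩⟩
    · exfalso
      have : μ = 0 := Measure.eq_zero_of_isEmpty μ
      exact (NeZero.ne μ) this
    · exact (abs_nonneg _).trans (h₁b x)
  have hcov : ∀ t, tiltCov μ U t G₁ G₂ = tiltCov μ (D.indicator U) t G₁ G₂ := fun t =>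
    (tiltCov_congr_ae hae Filter.EventuallyEq.rfl Filter.EventuallyEq.rfl t).symm
  have hc3 : ∀ t, tiltCum3 μ U t G₁ G₂ = tiltCum3 μ (D.indicator U) t G₁ G₂ := fun t =>
    (tiltCum3_congr_ae hae Filter.EventuallyEq.rfl Filter.EventuallyEq.rfl t).symm
  have hc4 : ∀ t, tiltCum4 μ U t G₁ G₂ = tiltCum4 μ (D.indicator U) t G₁ G₂ := fun t =>
    (tiltCum4_congr_ae hae Filter.EventuallyEq.rfl Filter.EventuallyEq.rfl t).symm
  have hc5 : ∀ t, tiltCum5 μ U t G₁ G₂ = tiltCum5 μ (D.indicator U) t G₁ G₂ := fun t =>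
    (tiltCum5_congr_ae hae Filter.EventuallyEq.rfl Filter.EventuallyEq.rfl t).symm
  rw [hcov 1, hcov 0, hc3 0, hc4 0]
  refine tiltThirdOrder Ω μ (NeZero.ne μ) (D.indicator U) G₁ G₂ (hU.indicator hDm) h₁ h₂
    ⟨B, fun x => ⟨abs_indicator_le hB hUb x, h₁b x, h₂b x⟩⟩ K fun t ht => ?_
  rw [← hc5 t]
  exact hK t ht

end Tilt

/-! ## §2 The instance on `μ_D` along `tiltU β H` -/

namespace GaussNormalForm

variable {β : ℝ} {H : ℕ}

/-- ★★ **13u³ = `TiltThirdOrder` ON `D`** (`μ_D := (volume.restrict (smallField H s)).withDensity (ofReal ∘ gaussWeight β H)`, `U = tiltU β H`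
verbatim, UNtruncated): for `β > 0`, `s > 0`, measurable `G₁, G₂` with `|Gᵢ| ≤ B` everywhere and `|tiltU β H| ≤ B` on `smallField H s`,
`(∀ t ∈ [0,1], |κ₅,t(G₁,G₂; tiltU)| ≤ K) → |Cov₁(G₁,G₂) − Cov₀(G₁,G₂) − κ₃,₀(G₁,G₂; tiltU) − κ₄,₀(G₁,G₂; tiltU,tiltU)/2| ≤ K/6`. -/
theorem abs_tiltCov_sub_sub_tiltCum3_sub_half_tiltCum4_le_muD (hβ : 0 < β) {s : ℝ} (hs : 0 < s) {G₁ G₂ : (LandauFree H → E3) → ℝ}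
    (h₁ : Measurable G₁) (h₂ : Measurable G₂) {B : ℝ} (h₁b : ∀ a, |G₁ a| ≤ B) (h₂b : ∀ a, |G₂ a| ≤ B)
    (hUb : ∀ a ∈ smallField H s, |tiltU β H a| ≤ B) {K : ℝ}
    (hK : ∀ t ∈ Set.Icc (0 : ℝ) 1,
      |Tilt.tiltCum5 (((volume : Measure (LandauFree H → E3)).restrict (smallField H s)).withDensity fun a => ENNReal.ofReal (gaussWeight β H a))
        (tiltU β H) t G₁ G₂| ≤ K) :
    |Tilt.tiltCov (((volume : Measure (LandauFree H → E3)).restrict (smallField H s)).withDensity fun a => ENNReal.ofReal (gaussWeight β H a))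
          (tiltU β H) 1 G₁ G₂ -
        Tilt.tiltCov (((volume : Measure (LandauFree H → E3)).restrict (smallField H s)).withDensity fun a => ENNReal.ofReal (gaussWeight β H a))
          (tiltU β H) 0 G₁ G₂ -
        Tilt.tiltCum3 (((volume : Measure (LandauFree H → E3)).restrict (smallField H s)).withDensity fun a => ENNReal.ofReal (gaussWeight β H a))
          (tiltU β H) 0 G₁ G₂ -
        Tilt.tiltCum4 (((volume : Measure (LandauFree H → E3)).restrict (smallField H s)).withDensity fun a => ENNReal.ofReal (gaussWeight β H a))
          (tiltU β H) 0 G₁ G₂ / 2| ≤ K / 6 := by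
  haveI := Tilt.isFiniteMeasure_muD H hβ s
  haveI := neZero_muD (H := H) hβ hs
  exact Tilt.abs_tiltCov_sub_sub_tiltCum3_sub_tiltCum4_le_of_ae (ChartGauss.measurableSet_smallField s) (Tilt.ae_muD_mem_smallField H β s)
    (measurable_tiltU β H) h₁ h₂ h₁b h₂b hUb hK

/-- ★★ **13u³ for the plaquette-cost slots** (`G₁ = chartPlaqCost H x 1 2`, `G₂ = chartPlaqCost H y 1 2`, bounded by `4`; measurability and bounds
discharged by ✓`EdgeChartGaussian.measurable_chartPlaqCost` / ✓`TiltSup.abs_chartPlaqCost_le_four`), under `sup_D |tiltU β H| ≤ 1`. -/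
theorem abs_tiltCov_sub_sub_tiltCum3_sub_half_tiltCum4_le_muD_chartPlaqCost (hβ : 0 < β) {s : ℝ} (hs : 0 < s)
    (hU1 : ∀ a ∈ smallField H s, |tiltU β H a| ≤ 1) (x y : Literature.Probability.LatticeModels.Site 4) {K : ℝ}
    (hK : ∀ t ∈ Set.Icc (0 : ℝ) 1,
      |Tilt.tiltCum5 (((volume : Measure (LandauFree H → E3)).restrict (smallField H s)).withDensity fun a => ENNReal.ofReal (gaussWeight β H a))
        (tiltU β H) t (chartPlaqCost H x 1 2) (chartPlaqCost H y 1 2)| ≤ K) :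
    |Tilt.tiltCov (((volume : Measure (LandauFree H → E3)).restrict (smallField H s)).withDensity fun a => ENNReal.ofReal (gaussWeight β H a))
          (tiltU β H) 1 (chartPlaqCost H x 1 2) (chartPlaqCost H y 1 2) -
        Tilt.tiltCov (((volume : Measure (LandauFree H → E3)).restrict (smallField H s)).withDensity fun a => ENNReal.ofReal (gaussWeight β H a))
          (tiltU β H) 0 (chartPlaqCost H x 1 2) (chartPlaqCost H y 1 2) -
        Tilt.tiltCum3 (((volume : Measure (LandauFree H → E3)).restrict (smallField H s)).withDensity fun a => ENNReal.ofReal (gaussWeight β H a))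
          (tiltU β H) 0 (chartPlaqCost H x 1 2) (chartPlaqCost H y 1 2) -
        Tilt.tiltCum4 (((volume : Measure (LandauFree H → E3)).restrict (smallField H s)).withDensity fun a => ENNReal.ofReal (gaussWeight β H a))
          (tiltU β H) 0 (chartPlaqCost H x 1 2) (chartPlaqCost H y 1 2) / 2| ≤ K / 6 := by
  have hUb4 : ∀ a ∈ smallField H s, |tiltU β H a| ≤ 4 := fun a ha => (hU1 a ha).trans (by norm_num)
  exact abs_tiltCov_sub_sub_tiltCum3_sub_half_tiltCum4_le_muD hβ hs (EdgeChartGaussian.measurable_chartPlaqCost H x 1 2)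
    (EdgeChartGaussian.measurable_chartPlaqCost H y 1 2) (fun a => TiltSup.abs_chartPlaqCost_le_four (H := H) x 1 2 a)
    (fun a => TiltSup.abs_chartPlaqCost_le_four (H := H) y 1 2 a) hUb4 hK

end GaussNormalForm

end Summit.QuantumFields.YangMills.Theorems.AllWindowsColdBoxBoxHighLine

end
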